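import Summits.Parity.BatemanHorn.Theorems.SoloInformedTrapezoidCoefLow

/-!
# The trapezoid method: the block estimate with the frequency range split at `H₀` (profile form)

Informed soloist `solo-Parity-informed` (session 144), conjunct `BatemanHorn`, the `d ≥ 3` rung BELOW the parity
wall.  `SoloInformedTrapezoidBlock.norm_trapBlock_le` bounds one dyadic block
`Z(E, E'] = ∑_{E<e≤E'} (1/e) ∑_{0<h<e} K_e(h)·S_g(h; e)` of the trapezoid form against a hypothesis of the shape
`∑_{h≤H₁} |T(±h)| ≤ C·H₁·E^{1−η}` for ALL `H₁ ≤ E^θ` — at `H₁ = 1` a pointwise power saving for the Hooley sums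
summed over a dyadic block of moduli, which is far more than the method consumes there.  Here the frequency range
`1 ≤ |h| ≤ H` of the main part is split at a second cut `H₀ ≤ H` (in the application `H₀ ≍ E/X₀`):
* LOW frequencies `|h| ≤ H₀` are summed by parts in the modulus with the CONSTANT coefficient bounds of
  `SoloInformedTrapezoidCoefLow` (`|c_e(h)| ≤ D(N+1)/e`, `|c_{e+1}(h) − c_e(h)| ≤ D(N+1)(1 + 1/(2Δ) + 2πN H₀/E)/e²`),
  against `Λ₀ ≥ sup_t ∑_{h≤H₀} (|T_t(h)| + |T_t(−h)|)` (`T_t(h) = ∑_{E<i≤t} S_g(h; i)`), giving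
  `(D(N+1)/E)·(2 + 1/(2Δ) + 2πN H₀/E)·Λ₀` (`sum_norm_trapMainLow_le`);
* MID frequencies `H₀ < |h| ≤ H` keep the oscillatory bounds `D/(2|h|)`, `W₁/(e|h|) + W₂/e³` of
  `SoloInformedTrapezoidBlock`, against `Λ₁ ≥ sup_t ∑_{H₀<h≤H} (|T_t(h)| + |T_t(−h)|)/h` and
  `Λ₂ ≥ sup_t ∑_{H₀<h≤H} (|T_t(h)| + |T_t(−h)|)`, giving `(D/2 + W₁)Λ₁ + W₂Λ₂/E²` (`sum_norm_trapMainMid_le`);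
* the TAIL `|h| > H` is `SoloInformedTrapezoidBlock.norm_trapTail_le` unchanged.
The block estimate `norm_trapBlockProfile_le` is stated with the three abstract majorants `Λ₀, Λ₁, Λ₂`; the point is
that a hypothesis on the Hooley sums now enters ONLY through them, so that the scale PROFILE actually consumed by
the method (`o(E)` in `ℓ¹` over `|h| ≤ H₀ ≍ E/X₀`, harmonically weighted `ℓ¹` above) can be fed in as such.
-/

namespace Summit.Parity.BatemanHorn.Theorems

open Finset Polynomial
open Literature.NumberTheory.Sieve (polyRootCountMod)

/-! ### One sign against two signs -/

/-- `|F(±h)| ≤ |F(h)| + |F(−h)|`. [folklore] -/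
theorem norm_sgn_le (F : ℤ → ℂ) (sgn : ℤ) (hsgn : sgn = 1 ∨ sgn = -1) (h : ℕ) :
    ‖F (sgn * h)‖ ≤ ‖F h‖ + ‖F (-(h : ℤ))‖ := by
  rcases hsgn with rfl | rfl
  · simp only [one_mul]; linarith [norm_nonneg (F (-(h : ℤ)))]
  · simp only [neg_mul, one_mul]; linarith [norm_nonneg (F h)]

/-! ### The low-frequency main part -/

/-- **The low-frequency main part of one sign**: for `1 ≤ E ≤ E' ≤ 2E` and
`Λ₀ ≥ ∑_{h≤H₀} |T_t(±h)|` (`E ≤ t ≤ E'`),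
`∑_{h≤H₀} |∑_{E<e≤E'} c_e(±h)S_g(±h;e)| ≤ (D(N+1)/E)·(2 + 1/(2Δ) + 2πN·H₀/E)·Λ₀` (`N = X₀ + D + 2`). [this work] -/
theorem sum_norm_trapMainLow_le (g : ℤ[X]) {Δ : ℝ} (hΔ : 0 < Δ) (X₀ D : ℕ)
    (hz : ∀ k : ℕ, g.eval (k : ℤ) ≠ 0) {E E' H₀ : ℕ} (hE : 1 ≤ E) (hEE' : E ≤ E') (hE'2 : E' ≤ 2 * E)
    {Λ₀ : ℝ} (hΛ₀ : 0 ≤ Λ₀) (sgn : ℤ) (hsgn : sgn = 1 ∨ sgn = -1)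
    (hT : ∀ t ∈ Icc E E', ∑ h ∈ Icc 1 H₀, ‖∑ i ∈ Ioc E t, hooleySum g i (sgn * h)‖ ≤ Λ₀) :
    ∑ h ∈ Icc 1 H₀, ‖∑ e ∈ Ioc E E', trapCoef g Δ X₀ D e (sgn * h) * hooleySum g e (sgn * h)‖
      ≤ (D : ℝ) * ((X₀ + D + 3 : ℕ) : ℝ) / E
          * (2 + 1 / (2 * Δ) + 2 * Real.pi * ((X₀ + D + 2 : ℕ) : ℝ) * H₀ / E) * Λ₀ := by
  have hE0 : (0 : ℝ) < E := by exact_mod_cast hE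
  have habs : ∀ h : ℕ, |((sgn * (h : ℤ) : ℤ) : ℝ)| = h := by
    intro h
    have : |sgn * (h : ℤ)| = h := by rcases hsgn with rfl | rfl <;> simp
    exact_mod_cast this
  set N₁ : ℝ := ((X₀ + D + 3 : ℕ) : ℝ) with hN₁
  set N : ℝ := ((X₀ + D + 2 : ℕ) : ℝ) with hN
  have hN0 : 0 ≤ N := Nat.cast_nonneg _
  have hN₁0 : 0 ≤ N₁ := Nat.cast_nonneg _
  have key := sum_norm_sum_Ioc_mul_le_of_const (fun e h => trapCoef g Δ X₀ D e (sgn * h))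
    (fun e h => hooleySum g e (sgn * h)) (Icc 1 H₀) hE hEE' hE'2 (B₀ := (D : ℝ) * N₁ / E)
    (W := (D : ℝ) * N₁ * (1 + 1 / (2 * Δ) + 2 * Real.pi * N * H₀ / E)) (L₀ := Λ₀) (by positivity)
    (by positivity) hΛ₀ ?_ ?_ hT
  · refine key.trans (le_of_eq ?_)
    field_simp
    ring
  · -- boundary coefficients
    intro h _
    have hE'1 : 1 ≤ E' := hE.trans hEE'
    refine (norm_trapCoef_le_low g Δ X₀ D hE'1 _).trans ?_
    exact div_le_div_of_nonneg_left (by positivity) hE0 (by exact_mod_cast hEE')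
  · -- variation
    intro e he h hh
    rw [mem_Ioo] at he
    rw [mem_Icc] at hh
    have he1 : 1 ≤ e := by omega
    have he0 : (0 : ℝ) < e := by exact_mod_cast he1
    refine (norm_trapCoef_succ_sub_le_low g hΔ X₀ D he1 hz _).trans ?_
    rw [habs]
    refine div_le_div_of_nonneg_right (mul_le_mul_of_nonneg_left ?_ (by positivity)) (by positivity)
    have h1 : (h : ℝ) / e ≤ (H₀ : ℝ) / E := by
      rw [div_le_div_iff₀ he0 hE0]
      have hhH : (h : ℝ) ≤ H₀ := by exact_mod_cast hh.2
      have hEe : (E : ℝ) ≤ e := by exact_mod_cast he.1.le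
      exact mul_le_mul hhH hEe hE0.le (Nat.cast_nonneg _)
    have h2 : 2 * Real.pi * N * (h : ℝ) / e = 2 * Real.pi * N * ((h : ℝ) / e) := by ring
    have h3 : 2 * Real.pi * N * (H₀ : ℝ) / E = 2 * Real.pi * N * ((H₀ : ℝ) / E) := by ring
    rw [h2, h3]
    have := mul_le_mul_of_nonneg_left h1 (show 0 ≤ 2 * Real.pi * N by positivity)
    linarith

/-! ### The mid-frequency main part -/

/-- **The mid-frequency main part of one sign**: for `1 ≤ E ≤ E' ≤ 2E`, `2H + 1 ≤ E`, the vanishing of `a_e` on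
`m ≤ A + 1` (`e ≥ E`), and `Λ₁ ≥ ∑_{H₀<h≤H} |T_t(±h)|/h`, `Λ₂ ≥ ∑_{H₀<h≤H} |T_t(±h)|` (`E ≤ t ≤ E'`):
`∑_{H₀<h≤H} |∑_{E<e≤E'} c_e(±h)S_g(±h;e)| ≤ (D/2 + W₁)·Λ₁ + W₂·Λ₂/E²`. [this work] -/
theorem sum_norm_trapMainMid_le (g : ℤ[X]) {Δ : ℝ} (hΔ : 0 < Δ) (X₀ D : ℕ)
    (hz : ∀ k : ℕ, g.eval (k : ℤ) ≠ 0) {m₀ A : ℕ} (hA : m₀ ≤ A) (hA1 : 1 ≤ A)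
    (hmono : ∀ m m' : ℕ, m₀ ≤ m → m ≤ m' → (g.eval (m : ℤ)).natAbs ≤ (g.eval (m' : ℤ)).natAbs)
    {C₁ C₂ : ℝ}
    (hC₁ : ∀ m : ℕ, 1 ≤ m →
      |Real.log ((g.eval ((m : ℤ) + 1)).natAbs : ℝ) - Real.log ((g.eval (m : ℤ)).natAbs : ℝ)| ≤ C₁ / m)
    (hC₂ : ∀ m : ℕ, 1 ≤ m →
      |Real.log ((g.eval ((m : ℤ) + 2)).natAbs : ℝ) - 2 * Real.log ((g.eval ((m : ℤ) + 1)).natAbs : ℝ)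
        + Real.log ((g.eval (m : ℤ)).natAbs : ℝ)| ≤ C₂ / (m : ℝ) ^ 2)
    {E E' H₀ H : ℕ} (hE : 1 ≤ E) (hEE' : E ≤ E') (hE'2 : E' ≤ 2 * E) (hH : 2 * H + 1 ≤ E)
    (hvan : ∀ e : ℕ, E ≤ e → ∀ m : ℕ, m ≤ A + 1 → locWeight g Δ e m = 0)
    {Λ₁ Λ₂ : ℝ} (hΛ₁ : 0 ≤ Λ₁) (hΛ₂ : 0 ≤ Λ₂) (sgn : ℤ) (hsgn : sgn = 1 ∨ sgn = -1)
    (hT₁ : ∀ t ∈ Icc E E', ∑ h ∈ Ioc H₀ H, ‖∑ i ∈ Ioc E t, hooleySum g i (sgn * h)‖ / h ≤ Λ₁)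
    (hT₂ : ∀ t ∈ Icc E E', ∑ h ∈ Ioc H₀ H, ‖∑ i ∈ Ioc E t, hooleySum g i (sgn * h)‖ ≤ Λ₂) :
    ∑ h ∈ Ioc H₀ H, ‖∑ e ∈ Ioc E E', trapCoef g Δ X₀ D e (sgn * h) * hooleySum g e (sgn * h)‖
      ≤ ((D : ℝ) / 2 + (((D : ℝ) / (2 * Δ) + Real.pi / 8 * (((X₀ + D + 2 : ℕ) : ℝ)
            * (2 + D * C₁ / (2 * Δ * ((X₀ : ℝ) + 1)) + D * ((C₂ + 4 * C₁) / (2 * Δ * A))) + 4 * D) + D / 2)))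
          * Λ₁
        + (Real.pi ^ 2 * D * ((X₀ + D + 3 : ℕ) : ℝ) / 4) * Λ₂ / (E : ℝ) ^ 2 := by
  have hC₁0 : 0 ≤ C₁ := by have := hC₁ 1 le_rfl; simp at this; exact (abs_nonneg _).trans this
  have hC₂0 : 0 ≤ C₂ := by have := hC₂ 1 le_rfl; simp at this; exact (abs_nonneg _).trans this
  have habs : ∀ h : ℕ, |sgn * (h : ℤ)| = h := by intro h; rcases hsgn with rfl | rfl <;> simp
  have hcast : ∀ h : ℕ, |((sgn * (h : ℤ) : ℤ) : ℝ)| = h := fun h => by exact_mod_cast habs h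
  have hW₁0 : 0 ≤ (D : ℝ) / (2 * Δ) + Real.pi / 8 * (((X₀ + D + 2 : ℕ) : ℝ)
      * (2 + D * C₁ / (2 * Δ * ((X₀ : ℝ) + 1)) + D * ((C₂ + 4 * C₁) / (2 * Δ * A))) + 4 * D) + D / 2 := by
    positivity
  have key := sum_norm_sum_Ioc_mul_le_of_factorised_on (fun e h => trapCoef g Δ X₀ D e (sgn * h))
    (fun e h => hooleySum g e (sgn * h)) (Ioc H₀ H) hE hEE' hE'2 (B₀ := (D : ℝ) / 2)
    (W₁ := (D : ℝ) / (2 * Δ) + Real.pi / 8 * (((X₀ + D + 2 : ℕ) : ℝ)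
      * (2 + D * C₁ / (2 * Δ * ((X₀ : ℝ) + 1)) + D * ((C₂ + 4 * C₁) / (2 * Δ * A))) + 4 * D) + D / 2)
    (W₂ := Real.pi ^ 2 * D * ((X₀ + D + 3 : ℕ) : ℝ) / 4) (L₀ := Λ₂) (L₁ := Λ₁) (by positivity) hW₁0
    (by positivity) hΛ₂ hΛ₁ ?_ ?_ hT₁ hT₂
  · exact key.trans (le_of_eq (by ring))
  · -- boundary coefficients
    intro h hh
    rw [mem_Ioc] at hh
    have hh0 : sgn * (h : ℤ) ≠ 0 := by rcases hsgn with rfl | rfl <;> simp <;> omega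
    have hh2 : 2 * |sgn * (h : ℤ)| ≤ (E' : ℤ) := by rw [habs]; exact_mod_cast (by omega : 2 * h ≤ E')
    have := norm_trapCoef_le g hΔ X₀ D (hE.trans hEE') hz hA hmono (hvan E' hEE') hh0 hh2
    rw [hcast] at this
    simpa [div_div] using this
  · -- variation
    intro e he h hh
    rw [mem_Ioo] at he
    rw [mem_Ioc] at hh
    have hh0 : sgn * (h : ℤ) ≠ 0 := by rcases hsgn with rfl | rfl <;> simp <;> omega
    have hh2 : 2 * |sgn * (h : ℤ)| ≤ (e : ℤ) := by rw [habs]; exact_mod_cast (by omega : 2 * h ≤ e)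
    have := norm_trapCoef_succ_sub_le g hΔ X₀ D (by omega) hz hA hA1 hmono (hvan e he.1.le) hC₁ hC₂ hh0 hh2
    rw [hcast] at this
    exact this.trans (le_of_eq (by ring))

/-! ### The block estimate, profile form -/

/-- **THE BLOCK ESTIMATE, PROFILE FORM.**  For `1 ≤ E ≤ E' ≤ 2E`, `H₀ ≤ H`, `2H + 1 ≤ E`, the vanishing of
`a_e` on `m ≤ A + 1` (`e ≥ E`), and majorants `Λ₀, Λ₁, Λ₂` of
`∑_{h≤H₀} (|T_t(h)| + |T_t(−h)|)`, `∑_{H₀<h≤H} (|T_t(h)| + |T_t(−h)|)/h`, `∑_{H₀<h≤H} (|T_t(h)| + |T_t(−h)|)`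
over `E ≤ t ≤ E'` (`T_t(h) = ∑_{E<i≤t} S_g(h; i)`):
`‖Z(E,E']‖ ≤ 2·[(D(N+1)/E)(2 + 1/(2Δ) + 2πN H₀/E)·Λ₀ + (D/2 + W₁)·Λ₁ + W₂·Λ₂/E²] + V·E'²·R/(4(H+1))`
(`N = X₀ + D + 2`; `W₁, W₂, V, R` as in `SoloInformedTrapezoidBlock`). [this work] -/
theorem norm_trapBlockProfile_le (g : ℤ[X]) {Δ : ℝ} (hΔ : 0 < Δ) (X₀ D : ℕ)
    (hz : ∀ k : ℕ, g.eval (k : ℤ) ≠ 0) {m₀ A : ℕ} (hA : m₀ ≤ A) (hA1 : 1 ≤ A)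
    (hmono : ∀ m m' : ℕ, m₀ ≤ m → m ≤ m' → (g.eval (m : ℤ)).natAbs ≤ (g.eval (m' : ℤ)).natAbs)
    {C₁ C₂ : ℝ}
    (hC₁ : ∀ m : ℕ, 1 ≤ m →
      |Real.log ((g.eval ((m : ℤ) + 1)).natAbs : ℝ) - Real.log ((g.eval (m : ℤ)).natAbs : ℝ)| ≤ C₁ / m)
    (hC₂ : ∀ m : ℕ, 1 ≤ m →
      |Real.log ((g.eval ((m : ℤ) + 2)).natAbs : ℝ) - 2 * Real.log ((g.eval ((m : ℤ) + 1)).natAbs : ℝ)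
        + Real.log ((g.eval (m : ℤ)).natAbs : ℝ)| ≤ C₂ / (m : ℝ) ^ 2)
    {E E' H₀ H : ℕ} (hE : 1 ≤ E) (hEE' : E ≤ E') (hE'2 : E' ≤ 2 * E) (hH₀ : H₀ ≤ H) (hH : 2 * H + 1 ≤ E)
    (hvan : ∀ e : ℕ, E ≤ e → ∀ m : ℕ, m ≤ A + 1 → locWeight g Δ e m = 0)
    {Λ₀ Λ₁ Λ₂ : ℝ} (hΛ₀ : 0 ≤ Λ₀) (hΛ₁ : 0 ≤ Λ₁) (hΛ₂ : 0 ≤ Λ₂)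
    (hT₀ : ∀ t ∈ Icc E E', ∑ h ∈ Icc 1 H₀,
      (‖∑ i ∈ Ioc E t, hooleySum g i h‖ + ‖∑ i ∈ Ioc E t, hooleySum g i (-(h : ℤ))‖) ≤ Λ₀)
    (hT₁ : ∀ t ∈ Icc E E', ∑ h ∈ Ioc H₀ H,
      (‖∑ i ∈ Ioc E t, hooleySum g i h‖ + ‖∑ i ∈ Ioc E t, hooleySum g i (-(h : ℤ))‖) / h ≤ Λ₁)
    (hT₂ : ∀ t ∈ Icc E E', ∑ h ∈ Ioc H₀ H,
      (‖∑ i ∈ Ioc E t, hooleySum g i h‖ + ‖∑ i ∈ Ioc E t, hooleySum g i (-(h : ℤ))‖) ≤ Λ₂) :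
    ‖∑ e ∈ Ioc E E', 1 / (e : ℂ) * ∑ h ∈ Ico 1 e, trapKernel g Δ X₀ D e h * hooleySum g e h‖
      ≤ 2 * ((D : ℝ) * ((X₀ + D + 3 : ℕ) : ℝ) / E
              * (2 + 1 / (2 * Δ) + 2 * Real.pi * ((X₀ + D + 2 : ℕ) : ℝ) * H₀ / E) * Λ₀
            + ((D : ℝ) / 2 + (((D : ℝ) / (2 * Δ) + Real.pi / 8 * (((X₀ + D + 2 : ℕ) : ℝ)
                * (2 + D * C₁ / (2 * Δ * ((X₀ : ℝ) + 1)) + D * ((C₂ + 4 * C₁) / (2 * Δ * A))) + 4 * D) + D / 2)))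
              * Λ₁
            + (Real.pi ^ 2 * D * ((X₀ + D + 3 : ℕ) : ℝ) / 4) * Λ₂ / (E : ℝ) ^ 2)
        + (2 + D * C₁ / (2 * Δ * ((X₀ : ℝ) + 1)) + D * ((C₂ + 4 * C₁) / (2 * Δ * A))) * (E' : ℝ) ^ 2
          * (∑ e ∈ Ioc E E', (polyRootCountMod ![g] e : ℝ) / e) / (4 * ((H : ℝ) + 1)) := by
  have hvan0 : ∀ e : ℕ, E < e → locWeight g Δ e 0 = 0 := fun e he => hvan e he.le 0 (by omega)
  rw [trapBlock_eq g Δ X₀ D hH hvan0]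
  -- one-sign hypotheses
  have hT₀' : ∀ sgn : ℤ, sgn = 1 ∨ sgn = -1 → ∀ t ∈ Icc E E',
      ∑ h ∈ Icc 1 H₀, ‖∑ i ∈ Ioc E t, hooleySum g i (sgn * h)‖ ≤ Λ₀ := fun sgn hsgn t ht =>
    (sum_le_sum fun h _ => norm_sgn_le (fun k => ∑ i ∈ Ioc E t, hooleySum g i k) sgn hsgn h).trans (hT₀ t ht)
  have hT₁' : ∀ sgn : ℤ, sgn = 1 ∨ sgn = -1 → ∀ t ∈ Icc E E',
      ∑ h ∈ Ioc H₀ H, ‖∑ i ∈ Ioc E t, hooleySum g i (sgn * h)‖ / h ≤ Λ₁ := fun sgn hsgn t ht =>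
    (sum_le_sum fun h _ => div_le_div_of_nonneg_right
      (norm_sgn_le (fun k => ∑ i ∈ Ioc E t, hooleySum g i k) sgn hsgn h) (Nat.cast_nonneg _)).trans (hT₁ t ht)
  have hT₂' : ∀ sgn : ℤ, sgn = 1 ∨ sgn = -1 → ∀ t ∈ Icc E E',
      ∑ h ∈ Ioc H₀ H, ‖∑ i ∈ Ioc E t, hooleySum g i (sgn * h)‖ ≤ Λ₂ := fun sgn hsgn t ht =>
    (sum_le_sum fun h _ => norm_sgn_le (fun k => ∑ i ∈ Ioc E t, hooleySum g i k) sgn hsgn h).trans (hT₂ t ht)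
  -- the four main pieces
  have hlowP := sum_norm_trapMainLow_le g hΔ X₀ D hz hE hEE' hE'2 hΛ₀ 1 (Or.inl rfl) (hT₀' 1 (Or.inl rfl))
  have hlowM := sum_norm_trapMainLow_le g hΔ X₀ D hz hE hEE' hE'2 hΛ₀ (-1) (Or.inr rfl) (hT₀' (-1) (Or.inr rfl))
  have hmidP := sum_norm_trapMainMid_le g hΔ X₀ D hz hA hA1 hmono hC₁ hC₂ hE hEE' hE'2 hH hvan hΛ₁ hΛ₂ 1
    (Or.inl rfl) (hT₁' 1 (Or.inl rfl)) (hT₂' 1 (Or.inl rfl))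
  have hmidM := sum_norm_trapMainMid_le g hΔ X₀ D hz hA hA1 hmono hC₁ hC₂ hE hEE' hE'2 hH hvan hΛ₁ hΛ₂ (-1)
    (Or.inr rfl) (hT₁' (-1) (Or.inr rfl)) (hT₂' (-1) (Or.inr rfl))
  simp only [one_mul] at hlowP hmidP
  simp only [neg_mul, one_mul] at hlowM hmidM
  have htail := norm_trapTail_le g hΔ X₀ D hz hA hA1 hmono hC₁ hC₂ (E' := E') (H := H) hE hvan
  -- split the main sums at `H₀`
  have hmainP : ‖∑ h ∈ Icc 1 H, ∑ e ∈ Ioc E E', trapCoef g Δ X₀ D e h * hooleySum g e h‖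
      ≤ ∑ h ∈ Icc 1 H₀, ‖∑ e ∈ Ioc E E', trapCoef g Δ X₀ D e h * hooleySum g e h‖
        + ∑ h ∈ Ioc H₀ H, ‖∑ e ∈ Ioc E E', trapCoef g Δ X₀ D e h * hooleySum g e h‖ := by
    rw [sum_Icc_one_eq_sum_Icc_add_sum_Ioc _ hH₀]
    exact (norm_add_le _ _).trans (add_le_add (norm_sum_le _ _) (norm_sum_le _ _))
  have hmainM : ‖∑ k ∈ Icc 1 H, ∑ e ∈ Ioc E E', trapCoef g Δ X₀ D e (-(k : ℤ)) * hooleySum g e (-(k : ℤ))‖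
      ≤ ∑ k ∈ Icc 1 H₀, ‖∑ e ∈ Ioc E E', trapCoef g Δ X₀ D e (-(k : ℤ)) * hooleySum g e (-(k : ℤ))‖
        + ∑ k ∈ Ioc H₀ H, ‖∑ e ∈ Ioc E E', trapCoef g Δ X₀ D e (-(k : ℤ)) * hooleySum g e (-(k : ℤ))‖ := by
    rw [sum_Icc_one_eq_sum_Icc_add_sum_Ioc _ hH₀]
    exact (norm_add_le _ _).trans (add_le_add (norm_sum_le _ _) (norm_sum_le _ _))
  refine (norm_add_le _ _).trans ?_
  refine (add_le_add ((norm_add_le _ _).trans (add_le_add hmainP hmainM)) htail).trans ?_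
  linarith

end Summit.Parity.BatemanHorn.Theorems
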